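import Summits.ResolutionOfSingularities.ResolutionOfSingularities.Theorems.FrobeniusLadderFInjectiveMacaulayficationX2Cubic4FloorTwoYChart
import Summits.ResolutionOfSingularities.ResolutionOfSingularities.Theorems.FrobeniusLadderFInjectiveMacaulayficationE4FloorTwoCharts
import HarnessLib

/-!
# (RR-I2) floor 2: the five charts of `Bl_𝔪 Y`, `Y = {x² + y³ + u³ + t³ + s³}` — `D₊(x)` is regular, and on `D₊(u)`, `D₊(t)`, `D₊(s)` the blowing up along the singular surface is
# regular, `Sing = V(J_i)`, `J_i` prime (by the variable swaps `(0 1)`, `(0 2)`, `(0 3)` from the `D₊(y)` chart of `X2Cubic4FloorTwoYChart`); every field with `3 ≠ 0`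
# (T″-side second kernel instance; crux `FInjectiveMacaulayfication` stmt-ResolutionOfSingularities-15315, chain w45a; template = res-L1-w45a-stub-1's `E4FloorTwoCharts`;
# seat res-L1-w45a-lead-1 g11)

[OURS · L1 W4.5a] Support file (`--supports stmt-ResolutionOfSingularities-15315 --as helper`); replaces the role of NO printed item; NOT a statement of any
manuscript; def-free; UNCONDITIONAL. AI-written (AI review is weaker than expert review).

* §1 `isRegularRing_chartFour` — `C₄ = k[X]/(1 + X₄(X₀³ + X₁³ + X₂³ + X₃³))` (the `x`-chart, which misses the exceptional divisor) is a REGULAR ring: `∂_{X₄} g₄ = X₀³ + ⋯ + X₃³`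
  is a unit modulo `g₄` (inverse `−X₄`; Stacks 07PF). Any field.
* §2 generic: `exists_quotientEquiv_rename₃` (a variable permutation `σ` with `σ·g′ = g`, `σ·c′ = c` induces `k[X]/(g′) ≃+* k[X]/(g)` matching the three-generator centres);
  `transport_of_quotientEquiv₃` (the two chart-ring regularities, `Sing = V(J)`, primality and the reduction relation `c̄₀² = −c̄₁c̄₂` descend along such a bridge).
* §3 charts `D₊(u)` (`g₁ = X₄² + X₁X₀³ + X₁ + X₁X₂³ + X₁X₃³`, `c₁ = (X₄, X₁, 1 + X₀³ + X₂³ + X₃³)`), `D₊(t)` (`g₂`, `c₂`), `D₊(s)` (`g₃`, `c₃`) in the letters of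
  `X2Cubic4PointFloor.theta`: ★★ `chartOne/Two/Three` (chart rings `C_i[J_i/c̄₁]`, `C_i[J_i/c̄₂]` regular ∧ `Sing(Spec C_i) = V(J_i)` ∧ `J_i` prime ∧ `c̄₀² = −c̄₁c̄₂`),
  ★★ `isRegular_affineBlowup_chartOne/Two/Three` (`Scheme.IsRegular (affineBlowup J_i)` by `X2YGBlowupRegular.isRegular_affineBlowup_of_sq_eq_neg_mul`) — `3 ≠ 0` in `k`.
[folklore; cite: Liu2002, Thm. 8.1.19 (a); StacksProject, Tag 07PF; GortzWedhorn2020, Prop. 13.96 (2), Prop. 13.91 (4)]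
-/

-- single-problem summit: the doubled namespace component is forced
set_option linter.dupNamespace false

noncomputable section

namespace Summit.ResolutionOfSingularities.ResolutionOfSingularities.Theorems.FInjectiveMacaulayfication.X2Cubic4FloorTwoCharts

open MvPolynomial Literature.AlgebraicGeometry.Resolution AlgebraicGeometry
open Summit.ResolutionOfSingularities.ResolutionOfSingularities.Theorems.FInjectiveMacaulayfication

/-! ## §1 The chart `D₊(x)` is regular -/

/-- **`C₄ = k[X₀..X₄]/(1 + X₄(X₀³ + X₁³ + X₂³ + X₃³))` is a regular ring** (any field): `∂g₄/∂X₄ = X₀³ + X₁³ + X₂³ + X₃³ =: q` and `X₄·q = g₄ − 1`, so `q̄` is a unit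
modulo `g₄` with inverse `−X̄₄` (Stacks 07PF, `isRegularRing_quotient_of_derivation`). [cite: StacksProject, Tag 07PF] -/
theorem isRegularRing_chartFour (k : Type) [Field k] (g₄ : MvPolynomial (Fin 5) k)
    (hg₄ : g₄ = 1 + X 4 * X 0 ^ 3 + X 4 * X 1 ^ 3 + X 4 * X 2 ^ 3 + X 4 * X 3 ^ 3) :
    IsRegularRing (MvPolynomial (Fin 5) k ⧸ Ideal.span {g₄}) := by
  have hd : (pderiv 4 : Derivation k (MvPolynomial (Fin 5) k) (MvPolynomial (Fin 5) k)) g₄ = X 0 ^ 3 + X 1 ^ 3 + X 2 ^ 3 + X 3 ^ 3 := by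
    rw [hg₄]
    simp only [map_add, Derivation.leibniz, Derivation.leibniz_pow, Derivation.map_one_eq_zero, pderiv_X_self,
      pderiv_X_of_ne (show (0 : Fin 5) ≠ 4 by decide), pderiv_X_of_ne (show (1 : Fin 5) ≠ 4 by decide),
      pderiv_X_of_ne (show (2 : Fin 5) ≠ 4 by decide), pderiv_X_of_ne (show (3 : Fin 5) ≠ 4 by decide),
      smul_eq_mul, mul_zero, smul_zero, mul_one, zero_add]
  refine isRegularRing_quotient_of_derivation g₄ (pderiv 4 : Derivation k (MvPolynomial (Fin 5) k) (MvPolynomial (Fin 5) k)) ?_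
  rw [hd]
  refine IsUnit.of_mul_eq_one (Ideal.Quotient.mk (Ideal.span {g₄}) (-X 4)) ?_
  rw [← map_mul, ← (Ideal.Quotient.mk (Ideal.span {g₄})).map_one, Ideal.Quotient.eq, Ideal.mem_span_singleton]
  refine ⟨-1, ?_⟩
  rw [hg₄]
  ring

/-! ## §2 Generic: permutation bridges for three-generator centres -/

/-- **A permutation of the variables with `σ·g′ = g`, `σ·c′ = c` induces `k[X]/(g′) ≃+* k[X]/(g)` carrying the centre `(c′)` onto `(c)` generator by generator**
(three generators; `E4FloorTwoCharts.exists_quotientEquiv_rename` is the four-generator twin). [folklore] -/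
theorem exists_quotientEquiv_rename₃ (k : Type) [Field k] (σ : Equiv.Perm (Fin 5)) (g g' : MvPolynomial (Fin 5) k) (hgg' : rename σ g' = g)
    (c c' : Fin 3 → MvPolynomial (Fin 5) k) (hcc' : ∀ p, rename σ (c' p) = c p)
    (J : Ideal (MvPolynomial (Fin 5) k ⧸ Ideal.span {g})) (hJ : J = (Ideal.span (Set.range c)).map (Ideal.Quotient.mk (Ideal.span {g})))
    (J' : Ideal (MvPolynomial (Fin 5) k ⧸ Ideal.span {g'})) (hJ' : J' = (Ideal.span (Set.range c')).map (Ideal.Quotient.mk (Ideal.span {g'}))) :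
    ∃ εq : (MvPolynomial (Fin 5) k ⧸ Ideal.span {g'}) ≃+* (MvPolynomial (Fin 5) k ⧸ Ideal.span {g}),
      (∀ p, εq (Ideal.Quotient.mk (Ideal.span {g'}) (c' p)) = Ideal.Quotient.mk (Ideal.span {g}) (c p)) ∧ Ideal.map εq J' = J := by
  let ε : MvPolynomial (Fin 5) k ≃+* MvPolynomial (Fin 5) k := (renameEquiv k σ).toRingEquiv
  have hε : ∀ x, ε x = rename σ x := fun x => rfl
  have hmap : Ideal.span {g} = (Ideal.span {g'}).map (ε : MvPolynomial (Fin 5) k →+* MvPolynomial (Fin 5) k) := by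
    rw [Ideal.map_span, Set.image_singleton]
    exact congrArg _ (congrArg _ (by rw [RingEquiv.coe_toRingHom, hε, hgg'])).symm
  let εq := Ideal.quotientEquiv (Ideal.span {g'}) (Ideal.span {g}) ε hmap
  have hεq : ∀ x, εq (Ideal.Quotient.mk (Ideal.span {g'}) x) = Ideal.Quotient.mk (Ideal.span {g}) (ε x) := fun x =>
    Ideal.quotientEquiv_mk _ _ _ _ x
  refine ⟨εq, fun p => by rw [hεq, hε, hcc'], ?_⟩
  have hcomp : (εq : _ →+* _).comp (Ideal.Quotient.mk (Ideal.span {g'})) =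
      (Ideal.Quotient.mk (Ideal.span {g})).comp (ε : MvPolynomial (Fin 5) k →+* MvPolynomial (Fin 5) k) :=
    RingHom.ext fun x => hεq x
  have hfun : ((ε : MvPolynomial (Fin 5) k →+* MvPolynomial (Fin 5) k) ∘ c' : Fin 3 → _) = c :=
    funext fun p => by rw [Function.comp_apply, RingEquiv.coe_toRingHom, hε]; exact hcc' p
  have key : Ideal.map (εq : _ →+* _) J' = J := by
    rw [hJ', hJ, Ideal.map_map, hcomp, ← Ideal.map_map, Ideal.map_span, ← Set.range_comp, hfun]
  exact key

/-- **Transport package along a quotient bridge `εq : C′ ≃+* C` matching three-generator centres**: the two chart-ring regularities (indices `1`, `2`), `Sing = V(J)`,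
primality, and the reduction relation `c̄₀² = −c̄₁c̄₂` descend from `C` to `C′`. [plumbing] -/
theorem transport_of_quotientEquiv₃ {A B : Type} [CommRing A] [CommRing B] (εq : A ≃+* B) (c' : Fin 3 → A) (c : Fin 3 → B)
    (hc : ∀ p, εq (c' p) = c p) (J' : Ideal A) (J : Ideal B) (hJ : Ideal.map εq J' = J)
    (hreg : IsRegularRing (blowupAlgebra J (c 1)) ∧ IsRegularRing (blowupAlgebra J (c 2)))
    (hsing : ∀ (Q : Ideal B) [Q.IsPrime], ¬ IsRegularLocalRing (Localization.AtPrime Q) ↔ J ≤ Q) (hprime : J.IsPrime)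
    (hrel : c 0 ^ 2 = -(c 1 * c 2)) :
    (IsRegularRing (blowupAlgebra J' (c' 1)) ∧ IsRegularRing (blowupAlgebra J' (c' 2))) ∧
      (∀ (P : Ideal A) [P.IsPrime], ¬ IsRegularLocalRing (Localization.AtPrime P) ↔ J' ≤ P) ∧ J'.IsPrime ∧ c' 0 ^ 2 = -(c' 1 * c' 2) := by
  have hJ'c : J' = J.comap εq := by
    rw [← hJ]; exact (Ideal.comap_map_of_bijective εq εq.bijective).symm
  refine ⟨⟨E4FloorTwoWChart.isRegularRing_blowupAlgebra_of_ringEquiv εq J' (c' 1) J (c 1) hJ.symm (hc 1).symm hreg.1,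
    E4FloorTwoWChart.isRegularRing_blowupAlgebra_of_ringEquiv εq J' (c' 2) J (c 2) hJ.symm (hc 2).symm hreg.2⟩, fun P _ => ?_, ?_, ?_⟩
  · haveI hQ : (P.map εq).IsPrime := Ideal.map_isPrime_of_equiv εq
    have hPc : P = (P.map εq).comap εq := (Ideal.comap_map_of_bijective εq εq.bijective).symm
    rw [E4FloorTwoWChart.isRegularLocalRing_localization_iff_of_ringEquiv εq P (P.map εq) hPc, hsing, ← hJ, Ideal.map_le_iff_le_comap, ← hPc]
  · rw [hJ'c]; exact Ideal.comap_isPrime εq J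
  · apply εq.injective
    rw [map_pow, map_neg, map_mul, hc 0, hc 1, hc 2, hrel]

/-! ## §3 The charts `D₊(u)`, `D₊(t)`, `D₊(s)` by the variable swaps `(0 1)`, `(0 2)`, `(0 3)` -/

/-- The `y`-chart package of `X2Cubic4FloorTwoYChart`, bundled in the transport currency. [plumbing] -/
theorem chartZero (k : Type) [Field k] (h3 : (3 : k) ≠ 0)
    (g₀ : MvPolynomial (Fin 5) k) (hg₀ : g₀ = X 4 ^ 2 + X 0 + X 0 * X 1 ^ 3 + X 0 * X 2 ^ 3 + X 0 * X 3 ^ 3)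
    (c₀ : Fin 3 → MvPolynomial (Fin 5) k) (hc₀ : c₀ = ![X 4, X 0, 1 + X 1 ^ 3 + X 2 ^ 3 + X 3 ^ 3])
    (J₀ : Ideal (MvPolynomial (Fin 5) k ⧸ Ideal.span {g₀})) (hJ₀ : J₀ = (Ideal.span (Set.range c₀)).map (Ideal.Quotient.mk (Ideal.span {g₀}))) :
    (IsRegularRing (blowupAlgebra J₀ (Ideal.Quotient.mk (Ideal.span {g₀}) (c₀ 1))) ∧
        IsRegularRing (blowupAlgebra J₀ (Ideal.Quotient.mk (Ideal.span {g₀}) (c₀ 2)))) ∧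
      (∀ (P : Ideal (MvPolynomial (Fin 5) k ⧸ Ideal.span {g₀})) [P.IsPrime], ¬ IsRegularLocalRing (Localization.AtPrime P) ↔ J₀ ≤ P) ∧ J₀.IsPrime ∧
      Ideal.Quotient.mk (Ideal.span {g₀}) (c₀ 0) ^ 2 = -(Ideal.Quotient.mk (Ideal.span {g₀}) (c₀ 1) * Ideal.Quotient.mk (Ideal.span {g₀}) (c₀ 2)) :=
  ⟨X2Cubic4FloorTwoYChart.isRegularRing_blowupAlgebra_yChart k h3 g₀ hg₀ c₀ hc₀ J₀ hJ₀,
    fun P _ => X2Cubic4FloorTwoYChart.not_isRegularLocalRing_iff_yChart k h3 g₀ hg₀ c₀ hc₀ J₀ hJ₀ P,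
    X2Cubic4FloorTwoYChart.isPrime_yChart k h3 g₀ hg₀ c₀ hc₀ J₀ hJ₀, X2Cubic4FloorTwoYChart.mk_sq_eq_neg_mul k g₀ hg₀ c₀ hc₀⟩

/-- ★★ **Chart `D₊(u)`: `C₁ = k[X]/(g₁)`, `g₁ = X₄² + X₁X₀³ + X₁ + X₁X₂³ + X₁X₃³`, centre `J₁ = (X₄, X₁, 1 + X₀³ + X₂³ + X₃³)`** — the chart rings `C₁[J₁/c̄₁]`, `C₁[J₁/c̄₂]`
are regular, `Sing(Spec C₁) = V(J₁)`, `J₁` is prime, `c̄₀² = −c̄₁c̄₂` (`3 ≠ 0` in `k`); from the `D₊(y)` chart by the swap `(0 1)`. [folklore; cite: Liu2002, Thm. 8.1.19 (a)] -/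
theorem chartOne (k : Type) [Field k] (h3 : (3 : k) ≠ 0)
    (g₁ : MvPolynomial (Fin 5) k) (hg₁ : g₁ = X 4 ^ 2 + X 1 * X 0 ^ 3 + X 1 + X 1 * X 2 ^ 3 + X 1 * X 3 ^ 3)
    (c₁ : Fin 3 → MvPolynomial (Fin 5) k) (hc₁ : c₁ = ![X 4, X 1, 1 + X 0 ^ 3 + X 2 ^ 3 + X 3 ^ 3])
    (J₁ : Ideal (MvPolynomial (Fin 5) k ⧸ Ideal.span {g₁})) (hJ₁ : J₁ = (Ideal.span (Set.range c₁)).map (Ideal.Quotient.mk (Ideal.span {g₁}))) :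
    (IsRegularRing (blowupAlgebra J₁ (Ideal.Quotient.mk (Ideal.span {g₁}) (c₁ 1))) ∧
        IsRegularRing (blowupAlgebra J₁ (Ideal.Quotient.mk (Ideal.span {g₁}) (c₁ 2)))) ∧
      (∀ (P : Ideal (MvPolynomial (Fin 5) k ⧸ Ideal.span {g₁})) [P.IsPrime], ¬ IsRegularLocalRing (Localization.AtPrime P) ↔ J₁ ≤ P) ∧ J₁.IsPrime ∧
      Ideal.Quotient.mk (Ideal.span {g₁}) (c₁ 0) ^ 2 = -(Ideal.Quotient.mk (Ideal.span {g₁}) (c₁ 1) * Ideal.Quotient.mk (Ideal.span {g₁}) (c₁ 2)) := by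
  have hsw : ∀ j : Fin 5, rename (Equiv.swap (0 : Fin 5) 1) (X j : MvPolynomial (Fin 5) k) =
      X ((![1, 0, 2, 3, 4] : Fin 5 → Fin 5) j) := by
    intro j
    rw [E4FloorTwoCharts.rename_swap_X]
    congr 1
    revert j
    decide
  have hgg' : rename (Equiv.swap (0 : Fin 5) 1) g₁ = X 4 ^ 2 + X 0 + X 0 * X 1 ^ 3 + X 0 * X 2 ^ 3 + X 0 * X 3 ^ 3 := by
    rw [hg₁]
    simp only [map_add, map_mul, map_pow, hsw]
    show (X 4 ^ 2 + X 0 * X 1 ^ 3 + X 0 + X 0 * X 2 ^ 3 + X 0 * X 3 ^ 3 : MvPolynomial (Fin 5) k) = X 4 ^ 2 + X 0 + X 0 * X 1 ^ 3 + X 0 * X 2 ^ 3 + X 0 * X 3 ^ 3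
    ring
  have hcc' : ∀ p, rename (Equiv.swap (0 : Fin 5) 1) (c₁ p) =
      (![X 4, X 0, 1 + X 1 ^ 3 + X 2 ^ 3 + X 3 ^ 3] : Fin 3 → MvPolynomial (Fin 5) k) p := by
    intro p
    subst hc₁
    fin_cases p
    · exact hsw 4
    · exact hsw 1
    · show rename _ (1 + X 0 ^ 3 + X 2 ^ 3 + X 3 ^ 3) = 1 + X 1 ^ 3 + X 2 ^ 3 + X 3 ^ 3
      simp only [map_add, map_pow, map_one, hsw]
      rfl
  obtain ⟨εq, hεq, hJ⟩ := exists_quotientEquiv_rename₃ k (Equiv.swap (0 : Fin 5) 1) _ g₁ hgg' _ c₁ hcc' _ rfl J₁ hJ₁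
  obtain ⟨hreg, hsing, hprime, hrel⟩ := chartZero k h3 _ rfl _ rfl _ rfl
  exact transport_of_quotientEquiv₃ εq _ _ hεq J₁ _ hJ hreg (fun Q _ => hsing Q) hprime hrel

/-- ★★ **`Bl_{J₁} Spec C₁` is a regular scheme** (`3 ≠ 0` in `k`). [folklore; cite: Liu2002, Thm. 8.1.19 (a); GortzWedhorn2020, Prop. 13.91 (4)] -/
theorem isRegular_affineBlowup_chartOne (k : Type) [Field k] (h3 : (3 : k) ≠ 0)
    (g₁ : MvPolynomial (Fin 5) k) (hg₁ : g₁ = X 4 ^ 2 + X 1 * X 0 ^ 3 + X 1 + X 1 * X 2 ^ 3 + X 1 * X 3 ^ 3)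
    (c₁ : Fin 3 → MvPolynomial (Fin 5) k) (hc₁ : c₁ = ![X 4, X 1, 1 + X 0 ^ 3 + X 2 ^ 3 + X 3 ^ 3])
    (J₁ : Ideal (MvPolynomial (Fin 5) k ⧸ Ideal.span {g₁})) (hJ₁ : J₁ = (Ideal.span (Set.range c₁)).map (Ideal.Quotient.mk (Ideal.span {g₁}))) :
    Scheme.IsRegular (affineBlowup J₁) := by
  obtain ⟨⟨r1, r2⟩, -, -, hrel⟩ := chartOne k h3 g₁ hg₁ c₁ hc₁ J₁ hJ₁
  refine X2YGBlowupRegular.isRegular_affineBlowup_of_sq_eq_neg_mul J₁ (fun l => Ideal.Quotient.mk (Ideal.span {g₁}) (c₁ l)) ?_ hrel r1 r2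
  rw [hJ₁, Ideal.map_span, ← Set.range_comp]
  rfl

/-- ★★ **Chart `D₊(t)`: `C₂ = k[X]/(g₂)`, `g₂ = X₄² + X₂X₀³ + X₂X₁³ + X₂ + X₂X₃³`, centre `J₂ = (X₄, X₂, 1 + X₀³ + X₁³ + X₃³)`** — same package (`3 ≠ 0` in `k`); from the
`D₊(y)` chart by the swap `(0 2)`. [folklore; cite: Liu2002, Thm. 8.1.19 (a)] -/
theorem chartTwo (k : Type) [Field k] (h3 : (3 : k) ≠ 0)
    (g₂ : MvPolynomial (Fin 5) k) (hg₂ : g₂ = X 4 ^ 2 + X 2 * X 0 ^ 3 + X 2 * X 1 ^ 3 + X 2 + X 2 * X 3 ^ 3)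
    (c₂ : Fin 3 → MvPolynomial (Fin 5) k) (hc₂ : c₂ = ![X 4, X 2, 1 + X 0 ^ 3 + X 1 ^ 3 + X 3 ^ 3])
    (J₂ : Ideal (MvPolynomial (Fin 5) k ⧸ Ideal.span {g₂})) (hJ₂ : J₂ = (Ideal.span (Set.range c₂)).map (Ideal.Quotient.mk (Ideal.span {g₂}))) :
    (IsRegularRing (blowupAlgebra J₂ (Ideal.Quotient.mk (Ideal.span {g₂}) (c₂ 1))) ∧
        IsRegularRing (blowupAlgebra J₂ (Ideal.Quotient.mk (Ideal.span {g₂}) (c₂ 2)))) ∧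
      (∀ (P : Ideal (MvPolynomial (Fin 5) k ⧸ Ideal.span {g₂})) [P.IsPrime], ¬ IsRegularLocalRing (Localization.AtPrime P) ↔ J₂ ≤ P) ∧ J₂.IsPrime ∧
      Ideal.Quotient.mk (Ideal.span {g₂}) (c₂ 0) ^ 2 = -(Ideal.Quotient.mk (Ideal.span {g₂}) (c₂ 1) * Ideal.Quotient.mk (Ideal.span {g₂}) (c₂ 2)) := by
  have hsw : ∀ j : Fin 5, rename (Equiv.swap (0 : Fin 5) 2) (X j : MvPolynomial (Fin 5) k) =
      X ((![2, 1, 0, 3, 4] : Fin 5 → Fin 5) j) := by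
    intro j
    rw [E4FloorTwoCharts.rename_swap_X]
    congr 1
    revert j
    decide
  have hgg' : rename (Equiv.swap (0 : Fin 5) 2) g₂ = X 4 ^ 2 + X 0 + X 0 * X 1 ^ 3 + X 0 * X 2 ^ 3 + X 0 * X 3 ^ 3 := by
    rw [hg₂]
    simp only [map_add, map_mul, map_pow, hsw]
    show (X 4 ^ 2 + X 0 * X 2 ^ 3 + X 0 * X 1 ^ 3 + X 0 + X 0 * X 3 ^ 3 : MvPolynomial (Fin 5) k) = X 4 ^ 2 + X 0 + X 0 * X 1 ^ 3 + X 0 * X 2 ^ 3 + X 0 * X 3 ^ 3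
    ring
  have hcc' : ∀ p, rename (Equiv.swap (0 : Fin 5) 2) (c₂ p) =
      (![X 4, X 0, 1 + X 1 ^ 3 + X 2 ^ 3 + X 3 ^ 3] : Fin 3 → MvPolynomial (Fin 5) k) p := by
    intro p
    subst hc₂
    fin_cases p
    · exact hsw 4
    · exact hsw 2
    · show rename _ (1 + X 0 ^ 3 + X 1 ^ 3 + X 3 ^ 3) = 1 + X 1 ^ 3 + X 2 ^ 3 + X 3 ^ 3
      simp only [map_add, map_pow, map_one, hsw]
      show (1 + X 2 ^ 3 + X 1 ^ 3 + X 3 ^ 3 : MvPolynomial (Fin 5) k) = 1 + X 1 ^ 3 + X 2 ^ 3 + X 3 ^ 3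
      ring
  obtain ⟨εq, hεq, hJ⟩ := exists_quotientEquiv_rename₃ k (Equiv.swap (0 : Fin 5) 2) _ g₂ hgg' _ c₂ hcc' _ rfl J₂ hJ₂
  obtain ⟨hreg, hsing, hprime, hrel⟩ := chartZero k h3 _ rfl _ rfl _ rfl
  exact transport_of_quotientEquiv₃ εq _ _ hεq J₂ _ hJ hreg (fun Q _ => hsing Q) hprime hrel

/-- ★★ **`Bl_{J₂} Spec C₂` is a regular scheme** (`3 ≠ 0` in `k`). [folklore; cite: Liu2002, Thm. 8.1.19 (a); GortzWedhorn2020, Prop. 13.91 (4)] -/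
theorem isRegular_affineBlowup_chartTwo (k : Type) [Field k] (h3 : (3 : k) ≠ 0)
    (g₂ : MvPolynomial (Fin 5) k) (hg₂ : g₂ = X 4 ^ 2 + X 2 * X 0 ^ 3 + X 2 * X 1 ^ 3 + X 2 + X 2 * X 3 ^ 3)
    (c₂ : Fin 3 → MvPolynomial (Fin 5) k) (hc₂ : c₂ = ![X 4, X 2, 1 + X 0 ^ 3 + X 1 ^ 3 + X 3 ^ 3])
    (J₂ : Ideal (MvPolynomial (Fin 5) k ⧸ Ideal.span {g₂})) (hJ₂ : J₂ = (Ideal.span (Set.range c₂)).map (Ideal.Quotient.mk (Ideal.span {g₂}))) :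
    Scheme.IsRegular (affineBlowup J₂) := by
  obtain ⟨⟨r1, r2⟩, -, -, hrel⟩ := chartTwo k h3 g₂ hg₂ c₂ hc₂ J₂ hJ₂
  refine X2YGBlowupRegular.isRegular_affineBlowup_of_sq_eq_neg_mul J₂ (fun l => Ideal.Quotient.mk (Ideal.span {g₂}) (c₂ l)) ?_ hrel r1 r2
  rw [hJ₂, Ideal.map_span, ← Set.range_comp]
  rfl

/-- ★★ **Chart `D₊(s)`: `C₃ = k[X]/(g₃)`, `g₃ = X₄² + X₃X₀³ + X₃X₁³ + X₃X₂³ + X₃`, centre `J₃ = (X₄, X₃, 1 + X₀³ + X₁³ + X₂³)`** — same package (`3 ≠ 0` in `k`); from the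
`D₊(y)` chart by the swap `(0 3)`. [folklore; cite: Liu2002, Thm. 8.1.19 (a)] -/
theorem chartThree (k : Type) [Field k] (h3 : (3 : k) ≠ 0)
    (g₃ : MvPolynomial (Fin 5) k) (hg₃ : g₃ = X 4 ^ 2 + X 3 * X 0 ^ 3 + X 3 * X 1 ^ 3 + X 3 * X 2 ^ 3 + X 3)
    (c₃ : Fin 3 → MvPolynomial (Fin 5) k) (hc₃ : c₃ = ![X 4, X 3, 1 + X 0 ^ 3 + X 1 ^ 3 + X 2 ^ 3])
    (J₃ : Ideal (MvPolynomial (Fin 5) k ⧸ Ideal.span {g₃})) (hJ₃ : J₃ = (Ideal.span (Set.range c₃)).map (Ideal.Quotient.mk (Ideal.span {g₃}))) :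
    (IsRegularRing (blowupAlgebra J₃ (Ideal.Quotient.mk (Ideal.span {g₃}) (c₃ 1))) ∧
        IsRegularRing (blowupAlgebra J₃ (Ideal.Quotient.mk (Ideal.span {g₃}) (c₃ 2)))) ∧
      (∀ (P : Ideal (MvPolynomial (Fin 5) k ⧸ Ideal.span {g₃})) [P.IsPrime], ¬ IsRegularLocalRing (Localization.AtPrime P) ↔ J₃ ≤ P) ∧ J₃.IsPrime ∧
      Ideal.Quotient.mk (Ideal.span {g₃}) (c₃ 0) ^ 2 = -(Ideal.Quotient.mk (Ideal.span {g₃}) (c₃ 1) * Ideal.Quotient.mk (Ideal.span {g₃}) (c₃ 2)) := by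
  have hsw : ∀ j : Fin 5, rename (Equiv.swap (0 : Fin 5) 3) (X j : MvPolynomial (Fin 5) k) =
      X ((![3, 1, 2, 0, 4] : Fin 5 → Fin 5) j) := by
    intro j
    rw [E4FloorTwoCharts.rename_swap_X]
    congr 1
    revert j
    decide
  have hgg' : rename (Equiv.swap (0 : Fin 5) 3) g₃ = X 4 ^ 2 + X 0 + X 0 * X 1 ^ 3 + X 0 * X 2 ^ 3 + X 0 * X 3 ^ 3 := by
    rw [hg₃]
    simp only [map_add, map_mul, map_pow, hsw]
    show (X 4 ^ 2 + X 0 * X 3 ^ 3 + X 0 * X 1 ^ 3 + X 0 * X 2 ^ 3 + X 0 : MvPolynomial (Fin 5) k) = X 4 ^ 2 + X 0 + X 0 * X 1 ^ 3 + X 0 * X 2 ^ 3 + X 0 * X 3 ^ 3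
    ring
  have hcc' : ∀ p, rename (Equiv.swap (0 : Fin 5) 3) (c₃ p) =
      (![X 4, X 0, 1 + X 1 ^ 3 + X 2 ^ 3 + X 3 ^ 3] : Fin 3 → MvPolynomial (Fin 5) k) p := by
    intro p
    subst hc₃
    fin_cases p
    · exact hsw 4
    · exact hsw 3
    · show rename _ (1 + X 0 ^ 3 + X 1 ^ 3 + X 2 ^ 3) = 1 + X 1 ^ 3 + X 2 ^ 3 + X 3 ^ 3
      simp only [map_add, map_pow, map_one, hsw]
      show (1 + X 3 ^ 3 + X 1 ^ 3 + X 2 ^ 3 : MvPolynomial (Fin 5) k) = 1 + X 1 ^ 3 + X 2 ^ 3 + X 3 ^ 3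
      ring
  obtain ⟨εq, hεq, hJ⟩ := exists_quotientEquiv_rename₃ k (Equiv.swap (0 : Fin 5) 3) _ g₃ hgg' _ c₃ hcc' _ rfl J₃ hJ₃
  obtain ⟨hreg, hsing, hprime, hrel⟩ := chartZero k h3 _ rfl _ rfl _ rfl
  exact transport_of_quotientEquiv₃ εq _ _ hεq J₃ _ hJ hreg (fun Q _ => hsing Q) hprime hrel

/-- ★★ **`Bl_{J₃} Spec C₃` is a regular scheme** (`3 ≠ 0` in `k`). [folklore; cite: Liu2002, Thm. 8.1.19 (a); GortzWedhorn2020, Prop. 13.91 (4)] -/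
theorem isRegular_affineBlowup_chartThree (k : Type) [Field k] (h3 : (3 : k) ≠ 0)
    (g₃ : MvPolynomial (Fin 5) k) (hg₃ : g₃ = X 4 ^ 2 + X 3 * X 0 ^ 3 + X 3 * X 1 ^ 3 + X 3 * X 2 ^ 3 + X 3)
    (c₃ : Fin 3 → MvPolynomial (Fin 5) k) (hc₃ : c₃ = ![X 4, X 3, 1 + X 0 ^ 3 + X 1 ^ 3 + X 2 ^ 3])
    (J₃ : Ideal (MvPolynomial (Fin 5) k ⧸ Ideal.span {g₃})) (hJ₃ : J₃ = (Ideal.span (Set.range c₃)).map (Ideal.Quotient.mk (Ideal.span {g₃}))) :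
    Scheme.IsRegular (affineBlowup J₃) := by
  obtain ⟨⟨r1, r2⟩, -, -, hrel⟩ := chartThree k h3 g₃ hg₃ c₃ hc₃ J₃ hJ₃
  refine X2YGBlowupRegular.isRegular_affineBlowup_of_sq_eq_neg_mul J₃ (fun l => Ideal.Quotient.mk (Ideal.span {g₃}) (c₃ l)) ?_ hrel r1 r2
  rw [hJ₃, Ideal.map_span, ← Set.range_comp]
  rfl

end Summit.ResolutionOfSingularities.ResolutionOfSingularities.Theorems.FInjectiveMacaulayfication.X2Cubic4FloorTwoCharts

end
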